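import Summits.CriticalPhenomena.SAWScalingLimit.Theorems.SAWDevelopingMapInteriorFlatteningOneMouthDefs
import Summits.CriticalPhenomena.SAWScalingLimit.Theses.SAWDevelopingMap

/-!
# `InteriorFlattening` (route SAWDevelopingMap, item stmt-CriticalPhenomena-8297): S6, conditional closures

Line `one-mouth-ball-reduction` for the crux (M) =
`Summit.CriticalPhenomena.SAWScalingLimit.Theses.SAWDevelopingMap.InteriorFlattening`, stub S6
"bounded distortion at some depth" (`DeepBoundedDistortion`):

  `∃ d₁ ≥ 0, ∃ K₁ ≥ 0, DepthFlat d₁ K₁`,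

i.e. at SOME fixed depth `d₁` the Beltrami mode `‖F{v,w₀} + ωF{v,w₁} + ω²F{v,w₂}‖` of the
Duminil-Copin–Smirnov parafermionic observable `F = F(a, ·, x_c, 5/8)` is at most `K₁` times the
monopole `‖F{v,w₀} + F{v,w₁} + F{v,w₂}‖`, uniformly over simply connected hexagonal domains, boundary
roots, `d₁`-deep vertices and labellings of the three neighbours.

As an unconditional statement S6 is open: it needs a lower bound on the monopole by the Beltrami mode,
and the vertex relations (DCS 2012, Lemma 1) together with the boundary values do not force one (an exact
zero of the monopole at a deep vertex is not excluded by them). This file records the two facts that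
place S6 in the route:

* `deepBoundedDistortion_of_noFoldBound` — S6 is IMPLIED by the sister crux (K) =
  `…SAWDevelopingMap.NoFoldBound` (item stmt-CriticalPhenomena-8296): a uniform contraction `k < 1` at
  EVERY vertex is in particular a bound `max k 0` at depth `0`;
* `deepBoundedDistortion_of_interiorFlattening` — S6 is NECESSARY for the crux (M) itself: (M) at
  `ε = 1` gives a radius `R` with `DepthFlat (max R 0) 1`.

Both are definitional unfoldings: `bel`, `mono`, `Fobs`, `omega`, `IsStar`, `Deep`, `DepthFlat` of the
Defs module are literally the two sides and the hypotheses of (K)/(M). Nothing unproved is asserted;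
(K) and (M) enter only as hypotheses.
-/

noncomputable section

open scoped BigOperators
open Literature.Probability.LatticeModels Literature.Probability.RandomPlanarGeometry.SAW

namespace Summit.CriticalPhenomena.SAWScalingLimit.Theorems.InteriorFlattening.OneMouth

/-- **S6 is implied by (K).** The sister crux `NoFoldBound` (stmt-CriticalPhenomena-8296: a uniform
contraction factor `k < 1` of the Beltrami mode by the monopole at every vertex of every simply
connected domain) gives bounded distortion at depth `d₁ = 0` with constant `K₁ = max k 0`; the depth
hypothesis is not even used. -/
theorem deepBoundedDistortion_of_noFoldBound :
    Summit.CriticalPhenomena.SAWScalingLimit.Theses.SAWDevelopingMap.NoFoldBound →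
      ∃ d₁ : ℝ, 0 ≤ d₁ ∧ ∃ K₁ : ℝ, 0 ≤ K₁ ∧ DepthFlat d₁ K₁ := by
  rintro ⟨k, -, hk⟩
  refine ⟨0, le_rfl, max k 0, le_max_right _ _, ?_⟩
  intro Λ hΛ a ha v hv _ w₀ w₁ w₂ hstar
  obtain ⟨h₀, h₁, h₂, h₀₁, h₁₂, h₀₂⟩ := hstar
  have h := hk Λ hΛ a ha v hv w₀ w₁ w₂ h₀ h₁ h₂ h₀₁ h₁₂ h₀₂
  dsimp only at h
  calc ‖bel Λ a v w₀ w₁ w₂‖ ≤ k * ‖mono Λ a v w₀ w₁ w₂‖ := h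
    _ ≤ max k 0 * ‖mono Λ a v w₀ w₁ w₂‖ :=
      mul_le_mul_of_nonneg_right (le_max_left _ _) (norm_nonneg _)

/-- **S6 is necessary for (M).** The crux `InteriorFlattening` itself, specialised to `ε = 1`, yields
a radius `R` such that the Beltrami mode is at most the monopole at every `R`-deep vertex; hence
bounded distortion holds at depth `d₁ = max R 0` with constant `K₁ = 1` (a `max R 0`-deep vertex is
`R`-deep). -/
theorem deepBoundedDistortion_of_interiorFlattening :
    Summit.CriticalPhenomena.SAWScalingLimit.Theses.SAWDevelopingMap.InteriorFlattening →
      ∃ d₁ : ℝ, 0 ≤ d₁ ∧ ∃ K₁ : ℝ, 0 ≤ K₁ ∧ DepthFlat d₁ K₁ := by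
  intro hM
  obtain ⟨R, hR⟩ := hM 1 one_pos
  refine ⟨max R 0, le_max_right _ _, 1, zero_le_one, ?_⟩
  intro Λ hΛ a ha v hv hdeep w₀ w₁ w₂ hstar
  obtain ⟨h₀, h₁, h₂, h₀₁, h₁₂, h₀₂⟩ := hstar
  have hball : ∀ w : HexVertex, dist (hexCenter w) (hexCenter v) ≤ R → w ∈ Λ :=
    fun w hw => hdeep w (hw.trans (le_max_left _ _))
  have h := hR Λ hΛ a ha v hv hball w₀ w₁ w₂ h₀ h₁ h₂ h₀₁ h₁₂ h₀₂
  dsimp only at h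
  exact h

end Summit.CriticalPhenomena.SAWScalingLimit.Theorems.InteriorFlattening.OneMouth

end
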